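import Literature.NumberTheory.PAdicHodge.KummerFilZeroCoboundarySupersingular
import HarnessLib

/-!
# The Kummer cocycle of a rational formal point dies in `H¹(F, B_dR⁺ ⊗ V_pW|_{Γ_F})` — the (S5a) currency
# `restrictedRationalTateRep`, for ANY equivariant matching `T_pW ≃ T_pŴ(𝒪_{ℂ_F})`

Topic `Literature/NumberTheory/PAdicHodge`; namespace `Literature.NumberTheory.PAdicHodge`. THEOREMS ONLY (no definition, no named
fact, no instance, no `sorry`). Sequel of `KummerFilZeroCoboundarySupersingular` (capstone for `rationalTateRep (W ×_ℤ F) p` and the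
tree's matching `tateGeomEquivTatePtSS`). Here the matching is ABSTRACTED: `W₀` is an elliptic curve over a subfield `K₀ ⊆ F` (the
literal setting of the cite-only (S5a) `expStarCoord_eq_zero_iff_kummer`, e.g. `K₀ = ℚ`, `F = ℚ_p`), and
`e : T_pW₀ ≃ T_pŴ(𝒪_{ℂ_F})` is any `ℤ_p`-linear matching with `e(σ|_{K̄₀} • a) = σ • e(a)` (e.g. the tree's `tateModuleEquiv W₀ F p`
composed with `tateGeomEquivTatePtSS` when `W₀ ×_{K₀} F = W ×_ℤ F`).

* **`isFilZeroCoboundary_kummerCocycle_restricted_of_matching`** (witness form) and the UNCONDITIONAL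
  **`isFilZeroCoboundary_kummerCocycle_restricted_of_matching_of_five_le`** (`p ≥ 5`, `p ∤ Δ_W`, `A_p(W mod p) = 0`): for every
  `[p]`-division sequence `u` of `Ŵ(𝔪_{ℂ_F})` with a `Γ_F`-fixed lift of its base point,
  `(bdRPeriodRingData hp).IsFilZeroCoboundary (restrictedRationalTateRep W₀ F p) (σ ↦ 1 ⊗ toRational (e⁻¹ (κ_u σ)))`.

(HT) from `exists_omegaPeriodHom_not_mem_filOne_sq` (Tate), (Nη) from `exists_tatePt_mulDefectC_not_mem` (η-Hasse). Brick K1 of the hT₂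
programme of crux K★ `stmt-BirchSwinnertonDyer-22226`. BSD / K★ are not proved by any of this.

## References
* [BlochKato1990] S. Bloch, K. Kato (1990), Ex. 3.10.1, (3.11.1), Lemma 3.8.1.
* [Kato1993LNM1553] K. Kato, LNM 1553 (1993), Ch. II §1.2.4, Lemma 1.4.3.
* [Tate1967] J. Tate, *p-divisible groups* (1967), §3.3, §4.
-/

noncomputable section

open scoped TensorProduct

namespace Literature.NumberTheory.PAdicHodge

open Literature Literature.NumberTheory.GaloisRepresentations Literature.NumberTheory.EllipticCurves WeierstrassCurve
open Literature.NumberTheory.GaloisRepresentations.IsNonarchimedeanLocalField Field ValuativeRel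
open Literature.NumberTheory.GaloisRepresentations.LubinTate

variable {F : Type} [Field F] [ValuativeRel F] [TopologicalSpace F] [IsNonarchimedeanLocalField F] [CharZero F]
  {p : ℕ} [Fact p.Prime] [Fact (¬ IsUnit (p : integerC F))] [IsAdicComplete (Ideal.span {(p : integerC F)}) (integerC F)]
  (hp : valuation F p < 1) [Algebra ℚ_[p] F]

/-- **K1 in the (S5a) currency, witness form.** `W/ℤ`; `W₀` elliptic over `K₀ ⊆ F` with an equivariant `ℤ_p`-matching
`e : T_pW₀ ≃ T_pŴ(𝒪_{ℂ_F})`; witnesses (HT) `∃ τ, ∫_τ ω ∉ Fil²` and (Nη) `∃ τ, R_p(τ₁) ∉ p𝒪_{ℂ_F}`; `u` a `[p]`-division sequence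
with a `Γ_F`-fixed lift `Q` of `u₀`. Then `σ ↦ 1 ⊗ e⁻¹(κ_u σ)` is a `Fil⁰`-coboundary of `B_dR(F) ⊗ V_pW₀|_{Γ_F}`.
[cite: BlochKato1990, Ex. 3.10.1, (3.11.1), Lemma 3.8.1] [cite: Kato1993LNM1553, Ch. II Lemma 1.4.3] -/
theorem isFilZeroCoboundary_kummerCocycle_restricted_of_matching (W : WeierstrassCurve ℤ)
    {K₀ : Type} [Field K₀] [CharZero K₀] (W₀ : WeierstrassCurve K₀) [W₀.IsElliptic] [Algebra K₀ F]
    (e : W₀.tateModule p ≃ₗ[ℤ_[p]] AinfTop.TatePt F p W)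
    (he : ∀ (σ : absoluteGaloisGroup F) (a : W₀.tateModule p), e (absGaloisRestrict K₀ F σ • a) = σ • e a)
    (hHT : ∃ τ : AinfTop.TatePt F p W, AinfTop.omegaPeriodHom W (surjective_fontaineTheta_integerC hp) τ ∉
      ((BdRPlusTop.filOne F p).toIdeal ^ 2 : Ideal (BdRPlusTop F p)))
    (hNη : ∃ τ : AinfTop.TatePt F p W, AinfTop.mulDefectC W p (AinfTop.seq W τ 1) ∉ Ideal.span {(p : CBall F)})
    {u : ℕ → (maxNilIdealC F).toIdeal} (hup : ∀ n, AinfTop.mulPC F p W (u (n + 1)) = u n)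
    {Q : W.Pt (AinfTop.nilTheta F p (surjective_fontaineTheta_integerC hp))}
    (hQ : AinfTop.thetaPt W (surjective_fontaineTheta_integerC hp) Q = ⟨u 0⟩)
    (hQσ : ∀ σ : absoluteGaloisGroup F, AinfTop.galPtN W (surjective_fontaineTheta_integerC hp) σ Q = Q) :
    (bdRPeriodRingData (F := F) (p := p) hp).IsFilZeroCoboundary (restrictedRationalTateRep W₀ F p) fun σ =>
      ((1 : (bdRPeriodRingData (F := F) (p := p) hp).B) ⊗ₜ[ℚ_[p]]
        TateModule.toRational p (e.symm (AinfTop.kummerCocycle W u hup (AinfTop.galCBall_base_eq_of_fixedLift W hQ hQσ) σ)) :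
        (bdRPeriodRingData (F := F) (p := p) hp).B ⊗[ℚ_[p]] W₀.rationalTateModule p) := by
  have hF := surjective_fontaineTheta_integerC hp
  -- rigidity of the `ℚ_p`-algebra structure of `F`
  have halg : ∀ c : ℚ_[p], algebraMap ℚ_[p] F c = LocalField.padicRingHom F p hp c := fun c =>
    RingHom.congr_fun (LocalField.ringHom_padic_ext _ _) c
  -- the bridge `B_dR⁺ → B_dR` and the two period functionals on `T_pW₀`
  let ιB : BdRPlusTop F p →+* (bdRPeriodRingData (F := F) (p := p) hp).B :=
    (algebraMap (BDeRhamPlus (integerC F) p) (FracBdR F p)).comp (BdRPlusTop.of F p).symm.toRingHom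
  have hιB : ∀ y, ιB y = algebraMap (BDeRhamPlus (integerC F) p) (FracBdR F p) ((BdRPlusTop.of F p).symm y) :=
    fun _ => rfl
  let φ₁ : W₀.tateModule p →+ (bdRPeriodRingData (F := F) (p := p) hp).B :=
    ιB.toAddMonoidHom.comp ((AinfTop.omegaPeriodHom W hF).comp e.toAddMonoidHom)
  let φ₂ : W₀.tateModule p →+ (bdRPeriodRingData (F := F) (p := p) hp).B :=
    ιB.toAddMonoidHom.comp ((AinfTop.etaPeriodHom W hF).comp e.toAddMonoidHom)
  have hφ₁ : ∀ a, φ₁ a = ιB (AinfTop.omegaPeriodHom W hF (e a)) := fun _ => rfl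
  have hφ₂ : ∀ a, φ₂ a = ιB (AinfTop.etaPeriodHom W hF (e a)) := fun _ => rfl
  have hsc : ∀ (c : ℤ_[p]) (y : BdRPlusTop F p),
      ιB (BdRPlusTop.of F p (qpToBdR (c : ℚ_[p])) * y) = (c : ℚ_[p]) • ιB y := fun c y => by
    rw [map_mul, Algebra.smul_def, PeriodRingData.algebraMap_eq]
    congr 1
    change algebraMap (BDeRhamPlus (integerC F) p) (FracBdR F p) (qpToBdR (c : ℚ_[p])) =
      algebraMap (BDeRhamPlus (integerC F) p) (FracBdR F p) (embBdRHom hp hF (algebraMap ℚ_[p] F c))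
    rw [embBdRHom_algebraMap_padic hp hF halg]
  have hgal : ∀ (σ : absoluteGaloisGroup F) (y : BdRPlusTop F p), ιB (BdRPlusTop.gal F p σ y) = σ • ιB y := fun σ y => by
    change _ = σ • algebraMap (BDeRhamPlus (integerC F) p) (FracBdR F p) ((BdRPlusTop.of F p).symm y)
    rw [smul_algebraMap_fracBdR]
    rfl
  -- the integrating pair
  have hu₀ := AinfTop.galCBall_base_eq_of_fixedLift W hQ hQσ
  have hω : ∀ σ, BdRPlusTop.gal F p σ (AinfTop.bOmega W hup hQ) - AinfTop.bOmega W hup hQ =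
      AinfTop.omegaPeriodHom W hF (AinfTop.kummerCocycle W u hup hu₀ σ) :=
    AinfTop.gal_bOmega_sub_bOmega_eq_omegaPeriodHom W hup hQ hQσ
  have hη : ∀ σ, BdRPlusTop.gal F p σ (AinfTop.bEta W hup hQ) - AinfTop.bEta W hup hQ =
      AinfTop.etaPeriodHom W hF (AinfTop.kummerCocycle W u hup hu₀ σ) :=
    AinfTop.gal_bEta_sub_bEta_eq_etaPeriodHom W hup hQ hQσ
  refine isFilZeroCoboundary_restrictedRationalTateRep_of_periodHoms hp W₀ φ₁ φ₂ (fun c a => ?_) (fun c a => ?_)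
    (fun σ a => ?_) (fun σ a => ?_) (fun a => ?_) (fun a => ?_) ?_ ?_
    (fun σ => e.symm (AinfTop.kummerCocycle W u hup hu₀ σ)) (b₁ := ιB (AinfTop.bOmega W hup hQ))
    (b₂ := ιB (AinfTop.bEta W hup hQ)) ?_ ?_ (fun σ => ?_) (fun σ => ?_)
  · rw [hφ₁, hφ₁, LinearEquiv.map_smul, AinfTop.omegaPeriodHom_smul', hsc]
  · rw [hφ₂, hφ₂, LinearEquiv.map_smul, AinfTop.etaPeriodHom_smul', hsc]
  · rw [hφ₁, hφ₁, he, ← AinfTop.gal_omegaPeriodHom, hgal]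
  · rw [hφ₂, hφ₂, he, ← AinfTop.gal_etaPeriodHom, hgal]
  · rw [hφ₁, hιB]
    exact (algebraMap_mem_fil_one_iff hp _).2 (AinfTop.omegaPeriodHom_mem_filOne W _)
  · rw [hφ₂, hιB]
    haveI : IsDomain (BDeRhamPlus (integerC F) p) := isDomain_bDeRhamPlus hF
    letI : Algebra F (FracBdR F p) := fracAlgebra hp hF
    exact algebraMap_mem_fil_zero hp hF _
  · obtain ⟨τ, hτ⟩ := hHT
    refine ⟨e.symm τ, fun h => hτ ?_⟩
    rw [hφ₁, LinearEquiv.apply_symm_apply, hιB] at h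
    exact mem_sq_of_algebraMap_mem_fil_two hp _ h
  · obtain ⟨τ, hτ⟩ := hNη
    refine ⟨e.symm τ, fun h => AinfTop.etaPeriodHom_not_mem_filOne W (hθ := hF) τ hτ
      ((algebraMap_mem_fil_one_iff hp (AinfTop.etaPeriodHom W hF τ)).1 ?_)⟩
    rwa [hφ₂, LinearEquiv.apply_symm_apply, hιB] at h
  · rw [hιB]
    exact (algebraMap_mem_fil_one_iff hp _).2 (AinfTop.bOmega_mem_filOne W hup hQ)
  · rw [hιB]
    haveI : IsDomain (BDeRhamPlus (integerC F) p) := isDomain_bDeRhamPlus hF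
    letI : Algebra F (FracBdR F p) := fracAlgebra hp hF
    exact algebraMap_mem_fil_zero hp hF _
  · rw [hφ₁, LinearEquiv.apply_symm_apply, ← hω σ, map_sub, hgal]
  · rw [hφ₂, LinearEquiv.apply_symm_apply, ← hη σ, map_sub, hgal]

/-- **K1 in the (S5a) currency, UNCONDITIONAL at `p ≥ 5` of good supersingular reduction**: with `W/ℤ`, `p ∤ Δ_W`,
`A_p(W mod p) = 0`, an equivariant matching `e : T_pW₀ ≃ T_pŴ(𝒪_{ℂ_F})` for `W₀` over `K₀ ⊆ F`, and a `[p]`-division sequence `u` with a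
`Γ_F`-fixed lift of its base point, the Kummer cocycle dies in `H¹(F, B_dR⁺ ⊗ V_pW₀|_{Γ_F})`:
`(bdRPeriodRingData hp).IsFilZeroCoboundary (restrictedRationalTateRep W₀ F p) (σ ↦ 1 ⊗ toRational (e⁻¹ (κ_u σ)))`.
[cite: BlochKato1990, Ex. 3.10.1, (3.11.1), Lemma 3.8.1] [cite: Tate1967, §4] [cite: Kato1993LNM1553, Ch. II Lemma 1.4.3] -/
theorem isFilZeroCoboundary_kummerCocycle_restricted_of_matching_of_five_le (W : WeierstrassCurve ℤ)
    (hp5 : 5 ≤ p) (hΔ : ¬ (p : ℤ) ∣ W.Δ) (hA : (W.map (Int.castRingHom (ZMod p))).hasseCoeff p = 0)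
    {K₀ : Type} [Field K₀] [CharZero K₀] (W₀ : WeierstrassCurve K₀) [W₀.IsElliptic] [Algebra K₀ F]
    (e : W₀.tateModule p ≃ₗ[ℤ_[p]] AinfTop.TatePt F p W)
    (he : ∀ (σ : absoluteGaloisGroup F) (a : W₀.tateModule p), e (absGaloisRestrict K₀ F σ • a) = σ • e a)
    {u : ℕ → (maxNilIdealC F).toIdeal} (hup : ∀ n, AinfTop.mulPC F p W (u (n + 1)) = u n)
    {Q : W.Pt (AinfTop.nilTheta F p (surjective_fontaineTheta_integerC hp))}
    (hQ : AinfTop.thetaPt W (surjective_fontaineTheta_integerC hp) Q = ⟨u 0⟩)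
    (hQσ : ∀ σ : absoluteGaloisGroup F, AinfTop.galPtN W (surjective_fontaineTheta_integerC hp) σ Q = Q) :
    (bdRPeriodRingData (F := F) (p := p) hp).IsFilZeroCoboundary (restrictedRationalTateRep W₀ F p) fun σ =>
      ((1 : (bdRPeriodRingData (F := F) (p := p) hp).B) ⊗ₜ[ℚ_[p]]
        TateModule.toRational p (e.symm (AinfTop.kummerCocycle W u hup (AinfTop.galCBall_base_eq_of_fixedLift W hQ hQσ) σ)) :
        (bdRPeriodRingData (F := F) (p := p) hp).B ⊗[ℚ_[p]] W₀.rationalTateModule p) :=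
  isFilZeroCoboundary_kummerCocycle_restricted_of_matching hp W W₀ e he
    (AinfTop.exists_omegaPeriodHom_not_mem_filOne_sq W hp5 hΔ hA) (AinfTop.exists_tatePt_mulDefectC_not_mem W (by omega) hΔ hA)
    hup hQ hQσ

end Literature.NumberTheory.PAdicHodge

end
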